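import Summits.KontsevichZagierPeriods.KontsevichZagierPeriods.Theorems.StandardPartsSpArcLiftingRawArcs
import Literature.NumberTheory.Transcendental.KZTameMoveFamily
import Literature.NumberTheory.Transcendental.KZVolumeConjectureProofs
import Literature.NumberTheory.Transcendental.KZKernelConjectureForms

/-!
# Route StandardParts — `SpArcLifting` (stmt-KontsevichZagierPeriods-3155): the BC2-redirect SPLIT GLUE

Problem `KontsevichZagierPeriods`, route `StandardParts`, crux item stmt-KontsevichZagierPeriods-3155
(`SpArcLifting`, summit-equivalent as typed: `summit_iff_spArcLifting_of_spArcClosure` of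
`StandardPartsSpArcLiftingRawArcs.lean` with item 3153 `SpArcClosure` closed). Crux-strategist
re-audit (RESTATED redirect, 2026-08-17): the crux is decomposed into THREE typed pieces, none of
which is the crux or the summit reworded, and this file is the sorry-free ASSEMBLY
`pieces → SpArcLifting` (to be used as `--glue-by` of `route edit --split SpArcLifting`).

The seam is Cresson–Viu-Sos' volume form of Conjecture 1, which is PROVED equivalent to the summit in
the tree (`KZ.kzPeriodConjecture'_iff_volumeConjectureCompact_holds`, over Viu-Sos' semi-canonical
reduction `KZ.semiCanonicalReduction_holds`, `KZVolumeConjectureProofs.lean`), cut along the route's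
own thesis "closure ∧ lifting" re-typed over TAME raw `ℚ`-semialgebraic families (`KZ.RawFamily`,
`KZ.TameUniformChainOn` of `KZTameMoveFamily.lean`):

* X₁ `SpVolumeArcLifting` (hypothesis `h₁`) — ARITHMETIC HALF on compact volume forms: two compact
  top-dimensional `ℚ`-semialgebraic bodies `K, K' ⊆ ℝᵈ` of equal volume are the `L¹`-endpoints
  (`t → 0⁺`) of two TAME raw arcs `S, S'` forming an ARC OF IDENTITIES (at every rational parameter
  `q ∈ (0,1)` all integral representations realising the fibres are `KZ.Equivalent`).
* X₂ `SpTameNoBlowUp` (`h₂`) — NO BLOW-UP: a tame arc of identities is UNIFORM near `0⁺`: on some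
  `(0, δ)` the difference of the fibre generators is ONE tame uniform chain (finitely many tame raw
  move families with signs, `KZ.TameUniformChainOn`).
* X₃ `SpTameUniformClosure` (`h₃`) — TAME UNIFORM CLOSURE: a tame uniform chain over `(0, δ)` between
  two tame raw families passes to their `L¹`-limits: the limits are `KZ.Equivalent` (the per-move tame
  closure lemmas of route InequalityCost — TameCovLimit, TameNLLimit, AddLimits — plus limits of the
  intermediate families and symbol bookkeeping).

Assembly (all landed ingredients): X₁ ∧ X₂ ∧ X₃ ⇒ `KZ.volumeConjectureCompact`
(`volumeConjectureCompact_of_pieces`: lift the pair of bodies to a tame arc of identities, uniformise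
it near `0⁺`, close at the endpoints; tameness bounds merged by `RawFamily.IsTame.mono` /
`TameUniformChainOn.mono`) ⇒ `KZPeriodConjecture'` (`KZ.kzPeriodConjecture'_of_volumeConjectureCompact`
with `KZ.semiCanonicalReduction_holds`) ⇒ the summit (`kzPeriodConjecture'_iff_isRational`) ⇒
`SpArcLifting` (constant typed arcs, `spArcLifting_of_summit`).

Sources: M. Kontsevich, D. Zagier, *Periods* (2001), §1.2 Conjecture 1 [KontsevichZagier2001];
J. Viu-Sos, IJNT 17 (2021), Thm. 1.1 [ViuSos2021]; J. Cresson, J. Viu-Sos, JTNB 34 (2022), §1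
p. 326 [CressonViusos2022]; L. van den Dries, *Tame topology and o-minimal structures* (1998),
Ch. 6 (1.2), Ch. 9 [Dries1998].
-/

noncomputable section

namespace Summit.KontsevichZagierPeriods.StandardParts

open Filter Set MeasureTheory Topology
open Literature.NumberTheory.Transcendental
open Summit.KontsevichZagierPeriods.KontsevichZagierPeriods.Theses.StandardParts (SpArcLifting)

/-- **The three pieces give the volume form of Conjecture 1** [Cresson–Viu-Sos 2022, §1 p. 326,
Conjecture]: for compact top-dimensional bodies `K, K'` of equal volume, X₁ lifts `(K, K')` to a tame
raw arc of identities with `L¹`-endpoints `(K, K')`, X₂ makes the arc uniform on some `(0, δ)`, and X₃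
closes at the endpoints. The hypotheses are LITERALLY the statements of the route's new leaves
`SpVolumeArcLifting`, `SpTameNoBlowUp`, `SpTameUniformClosure`.
[cite: CressonViusos2022, §1 p. 326] [cite: KontsevichZagier2001, §1.2 Conjecture 1] -/
theorem volumeConjectureCompact_of_pieces
    (h₁ : ∀ ⦃d : ℕ⦄ (K K' : KZ.IntegralRep d), IsCompact K.domain → (interior K.domain).Nonempty →
      IsCompact K'.domain → (interior K'.domain).Nonempty → (∀ x ∈ K.domain, K.integrand x = 1) →
      (∀ x ∈ K'.domain, K'.integrand x = 1) → K.value = K'.value →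
      ∃ (N : ℕ) (S S' : KZ.RawFamily d), S.IsTame N ∧ S'.IsTame N ∧
        (∀ q : ℚ, (q : ℝ) ∈ Set.Ioo (0:ℝ) 1 → ∀ (ρ ρ' : KZ.IntegralRep d),
          ρ.domain = S.fibre q → Set.EqOn ρ.integrand (S.fibreFun q) (S.fibre q) →
          ρ'.domain = S'.fibre q → Set.EqOn ρ'.integrand (S'.fibreFun q) (S'.fibre q) →
          KZ.Equivalent ρ ρ') ∧
        S.HasL1Limit K ∧ S'.HasL1Limit K')
    (h₂ : ∀ (N : ℕ) ⦃k k' : ℕ⦄ (S : KZ.RawFamily k) (S' : KZ.RawFamily k'), S.IsTame N → S'.IsTame N →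
      (∀ q : ℚ, (q : ℝ) ∈ Set.Ioo (0:ℝ) 1 → ∀ (ρ : KZ.IntegralRep k) (ρ' : KZ.IntegralRep k'),
        ρ.domain = S.fibre q → Set.EqOn ρ.integrand (S.fibreFun q) (S.fibre q) →
        ρ'.domain = S'.fibre q → Set.EqOn ρ'.integrand (S'.fibreFun q) (S'.fibre q) →
        KZ.Equivalent ρ ρ') →
      ∃ (N' : ℕ) (δ : ℚ), 0 < δ ∧
        KZ.TameUniformChainOn N' (Set.Ioo (0:ℝ) δ) (fun t => S.gen t - S'.gen t))
    (h₃ : ∀ (N : ℕ) (δ : ℚ) ⦃k k' : ℕ⦄ (S : KZ.RawFamily k) (S' : KZ.RawFamily k')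
      (ρ₀ : KZ.IntegralRep k) (ρ₀' : KZ.IntegralRep k'), 0 < δ → S.IsTame N → S'.IsTame N →
      KZ.TameUniformChainOn N (Set.Ioo (0:ℝ) δ) (fun t => S.gen t - S'.gen t) →
      S.HasL1Limit ρ₀ → S'.HasL1Limit ρ₀' → KZ.Equivalent ρ₀ ρ₀') :
    KZ.volumeConjectureCompact := by
  intro d K K' hc hi hc' hi' h1 h1' hv
  obtain ⟨N, S, S', hS, hS', hid, hl, hl'⟩ := h₁ K K' hc hi hc' hi' h1 h1' hv
  obtain ⟨N', δ, hδ, huc⟩ := h₂ N S S' hS hS' hid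
  exact h₃ (max N N') δ S S' K K' hδ (hS.mono (le_max_left N N')) (hS'.mono (le_max_left N N'))
    (huc.mono subset_rfl (le_max_right N N')) hl hl'

/-- **The three pieces give the summit**: the volume form (`volumeConjectureCompact_of_pieces`) is
equivalent to Conjecture 1 by Viu-Sos' semi-canonical reduction, DISCHARGED in the tree
(`KZ.kzPeriodConjecture'_of_volumeConjectureCompact` with `KZ.semiCanonicalReduction_holds`), and the
two-representation form `KZPeriodConjecture'` gives the summit's `IsRational` form
(`kzPeriodConjecture'_iff_isRational`). [cite: ViuSos2021, Thm. 1.1] [cite: CressonViusos2022, §1 p. 326]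
[cite: KontsevichZagier2001, §1.2 Conjecture 1] -/
theorem kontsevichZagierPeriods_of_pieces
    (h₁ : ∀ ⦃d : ℕ⦄ (K K' : KZ.IntegralRep d), IsCompact K.domain → (interior K.domain).Nonempty →
      IsCompact K'.domain → (interior K'.domain).Nonempty → (∀ x ∈ K.domain, K.integrand x = 1) →
      (∀ x ∈ K'.domain, K'.integrand x = 1) → K.value = K'.value →
      ∃ (N : ℕ) (S S' : KZ.RawFamily d), S.IsTame N ∧ S'.IsTame N ∧
        (∀ q : ℚ, (q : ℝ) ∈ Set.Ioo (0:ℝ) 1 → ∀ (ρ ρ' : KZ.IntegralRep d),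
          ρ.domain = S.fibre q → Set.EqOn ρ.integrand (S.fibreFun q) (S.fibre q) →
          ρ'.domain = S'.fibre q → Set.EqOn ρ'.integrand (S'.fibreFun q) (S'.fibre q) →
          KZ.Equivalent ρ ρ') ∧
        S.HasL1Limit K ∧ S'.HasL1Limit K')
    (h₂ : ∀ (N : ℕ) ⦃k k' : ℕ⦄ (S : KZ.RawFamily k) (S' : KZ.RawFamily k'), S.IsTame N → S'.IsTame N →
      (∀ q : ℚ, (q : ℝ) ∈ Set.Ioo (0:ℝ) 1 → ∀ (ρ : KZ.IntegralRep k) (ρ' : KZ.IntegralRep k'),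
        ρ.domain = S.fibre q → Set.EqOn ρ.integrand (S.fibreFun q) (S.fibre q) →
        ρ'.domain = S'.fibre q → Set.EqOn ρ'.integrand (S'.fibreFun q) (S'.fibre q) →
        KZ.Equivalent ρ ρ') →
      ∃ (N' : ℕ) (δ : ℚ), 0 < δ ∧
        KZ.TameUniformChainOn N' (Set.Ioo (0:ℝ) δ) (fun t => S.gen t - S'.gen t))
    (h₃ : ∀ (N : ℕ) (δ : ℚ) ⦃k k' : ℕ⦄ (S : KZ.RawFamily k) (S' : KZ.RawFamily k')
      (ρ₀ : KZ.IntegralRep k) (ρ₀' : KZ.IntegralRep k'), 0 < δ → S.IsTame N → S'.IsTame N →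
      KZ.TameUniformChainOn N (Set.Ioo (0:ℝ) δ) (fun t => S.gen t - S'.gen t) →
      S.HasL1Limit ρ₀ → S'.HasL1Limit ρ₀' → KZ.Equivalent ρ₀ ρ₀') :
    KontsevichZagierPeriods :=
  kzPeriodConjecture'_iff_isRational.mp
    (KZ.kzPeriodConjecture'_of_volumeConjectureCompact KZ.semiCanonicalReduction_holds
      (volumeConjectureCompact_of_pieces h₁ h₂ h₃))

/-- **ASSEMBLY of the split (BC2 redirect of stmt-KontsevichZagierPeriods-3155)**: the three pieces
give the crux `StandardParts.SpArcLifting` BY NAME — through the summit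
(`kontsevichZagierPeriods_of_pieces`) and constant typed arcs (`spArcLifting_of_summit`). Its type is,
up to unfolding the three new route decls, `SpVolumeArcLifting → SpTameNoBlowUp →
SpTameUniformClosure → SpArcLifting` (the `--glue-by` theorem of the split). The seam is NOT trivial
modus ponens: it runs through Viu-Sos' reduction (landed) and the merge of tameness bounds, and no
piece mentions `SpArcLifting`, the summit, or equal-valued rational pairs.
[cite: KontsevichZagier2001, §1.2 Conjecture 1] [cite: CressonViusos2022, §1 p. 326] -/
theorem spArcLifting_of_pieces
    (h₁ : ∀ ⦃d : ℕ⦄ (K K' : KZ.IntegralRep d), IsCompact K.domain → (interior K.domain).Nonempty →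
      IsCompact K'.domain → (interior K'.domain).Nonempty → (∀ x ∈ K.domain, K.integrand x = 1) →
      (∀ x ∈ K'.domain, K'.integrand x = 1) → K.value = K'.value →
      ∃ (N : ℕ) (S S' : KZ.RawFamily d), S.IsTame N ∧ S'.IsTame N ∧
        (∀ q : ℚ, (q : ℝ) ∈ Set.Ioo (0:ℝ) 1 → ∀ (ρ ρ' : KZ.IntegralRep d),
          ρ.domain = S.fibre q → Set.EqOn ρ.integrand (S.fibreFun q) (S.fibre q) →
          ρ'.domain = S'.fibre q → Set.EqOn ρ'.integrand (S'.fibreFun q) (S'.fibre q) →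
          KZ.Equivalent ρ ρ') ∧
        S.HasL1Limit K ∧ S'.HasL1Limit K')
    (h₂ : ∀ (N : ℕ) ⦃k k' : ℕ⦄ (S : KZ.RawFamily k) (S' : KZ.RawFamily k'), S.IsTame N → S'.IsTame N →
      (∀ q : ℚ, (q : ℝ) ∈ Set.Ioo (0:ℝ) 1 → ∀ (ρ : KZ.IntegralRep k) (ρ' : KZ.IntegralRep k'),
        ρ.domain = S.fibre q → Set.EqOn ρ.integrand (S.fibreFun q) (S.fibre q) →
        ρ'.domain = S'.fibre q → Set.EqOn ρ'.integrand (S'.fibreFun q) (S'.fibre q) →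
        KZ.Equivalent ρ ρ') →
      ∃ (N' : ℕ) (δ : ℚ), 0 < δ ∧
        KZ.TameUniformChainOn N' (Set.Ioo (0:ℝ) δ) (fun t => S.gen t - S'.gen t))
    (h₃ : ∀ (N : ℕ) (δ : ℚ) ⦃k k' : ℕ⦄ (S : KZ.RawFamily k) (S' : KZ.RawFamily k')
      (ρ₀ : KZ.IntegralRep k) (ρ₀' : KZ.IntegralRep k'), 0 < δ → S.IsTame N → S'.IsTame N →
      KZ.TameUniformChainOn N (Set.Ioo (0:ℝ) δ) (fun t => S.gen t - S'.gen t) →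
      S.HasL1Limit ρ₀ → S'.HasL1Limit ρ₀' → KZ.Equivalent ρ₀ ρ₀') :
    SpArcLifting :=
  spArcLifting_of_summit (kontsevichZagierPeriods_of_pieces h₁ h₂ h₃)

end Summit.KontsevichZagierPeriods.StandardParts
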